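import Mathlib
import Summits.Ventures.PercRepro2.SwOutCrossJunctionQAny
import Summits.Ventures.PercRepro2.SwOutCrossJunctionMarkU

/-!
# THE MARK ANYWHERE: Theorem A_cross for a cross junction whose mark is any vertex other than `h`
(blind cell PercRepro2, night-4 g27, 2026-08-28; proofs/NIGHT4-G27.md §6)

The junction theorems of record split by the position of the mark `o`: in a u-arm, a far arm or
outside the region (g25's `CrossJunction`, `hou : o ≠ u`, `hop : o ≠ p i`), at the junction
(g26's `CrossJunctionU`), at a dropped vertex (g26's `CrossJunctionQ`, now for any cross graph).
**`CrossJunctionM`** is their common part — the fields of `CrossJunction` without `hou` / `hop`,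
`hout` exempting the mark, and an outside edge at the mark when it is a dropped vertex — and each
of the three is `CrossJunctionM` with the case of the mark (`toCrossJunction`, `toU`, `toQ`, and
back: `CrossJunction.toM`, `CrossJunctionU.toM`, `CrossJunctionQ.toM`).  Hence
**`sw_of_crossJunctionM`**: rows (SW) / 2′SW-ALL on every graph with a cross junction (any
simple cross graph) whose mark is ANY vertex other than `h` — one statement for the whole
junction row.
-/

namespace Summit.Ventures.PercRepro2

namespace CrossArm

open Hull LocRows

universe u uV

variable {V : Type uV} {E : Type*}

section Vocabulary

variable {X : Type*}

/-- **The cross junction with the mark anywhere**: the junction `u` and the dropped vertices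
`p i` along the simple cross-edge graph `G`; `hout` exempts the mark `o`; a dropped mark carries
an outside edge. -/
structure CrossJunctionM (ends : E → Sym2 V) (U : Set V) (h u : V) (p : X → V)
    (G : SimpleGraph X) (o : V) : Prop where
  hne_hu : h ≠ u
  hne_hp : ∀ i, h ≠ p i
  hne_up : ∀ i, u ≠ p i
  p_inj : Function.Injective p
  hhU : h ∈ U
  huU : u ∈ U
  hpU : ∀ i, p i ∈ U
  hloop_h : ∀ e, ends e ≠ s(h, h)
  hloop_u : ∀ e, ends e ≠ s(u, u)
  hnadj : ∀ e, ends e ≠ s(h, u)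
  hnadj_p : ∀ i e, ends e ≠ s(h, p i)
  hup : ∀ i, ∃ e, ends e = s(u, p i)
  hcross : ∀ i j, G.Adj i j → ∃ e, ends e = s(p i, p j)
  hcross_adj : ∀ i j e, ends e = s(p i, p j) → G.Adj i j
  hcross_simple : ∀ i j e e', ends e = s(p i, p j) → ends e' = s(p i, p j) → e = e'
  hu_adj_h : ∀ e x, ends e = s(u, x) → (∀ i, x ≠ p i) → ∃ e', ends e' = s(x, h)
  hp_in : ∀ i e x, ends e = s(p i, x) → x ∈ U → x = u ∨ ∃ j, x = p j
  hout : ∀ x ∈ U, x ≠ h → x ≠ o → x ≠ u →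
    (∃ e y, ends e = s(x, y) ∧ y ∉ U) ∨ (∀ e, x ∉ ends e)
  /-- a dropped mark carries an outside edge -/
  hext_o : ∀ i, o = p i → ∃ e y, ends e = s(p i, y) ∧ y ∉ U ∧ y ≠ u ∧ ∀ j, y ≠ p j

variable {ends : E → Sym2 V} {U : Set V} {h u o : V} {p : X → V} {G : SimpleGraph X}

/-- The mark neither the junction nor a dropped vertex: a `CrossJunction`. -/
theorem CrossJunctionM.toCrossJunction (hj : CrossJunctionM ends U h u p G o) (hou : o ≠ u)
    (hop : ∀ i, o ≠ p i) : CrossJunction ends U h u p G o :=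
  ⟨hj.hne_hu, hj.hne_hp, hj.hne_up, hj.p_inj, hou, hop, hj.hhU, hj.huU, hj.hpU, hj.hloop_h,
    hj.hloop_u, hj.hnadj, hj.hnadj_p, hj.hup, hj.hcross, hj.hcross_adj, hj.hcross_simple,
    hj.hu_adj_h, hj.hp_in, hj.hout⟩

/-- The mark at the junction: a `CrossJunctionU`. -/
theorem CrossJunctionM.toU (hj : CrossJunctionM ends U h u p G o) (hou : o = u) :
    CrossJunctionU ends U h u p G :=
  ⟨hj.hne_hu, hj.hne_hp, hj.hne_up, hj.p_inj, hj.hhU, hj.huU, hj.hpU, hj.hloop_h, hj.hloop_u,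
    hj.hnadj, hj.hnadj_p, hj.hup, hj.hcross, hj.hcross_adj, hj.hcross_simple, hj.hu_adj_h,
    hj.hp_in, fun x hx hxh hxu => hj.hout x hx hxh (hou ▸ hxu) hxu⟩

/-- The mark at a dropped vertex: a `CrossJunctionQ`. -/
theorem CrossJunctionM.toQ (hj : CrossJunctionM ends U h u p G o) (r : X) (hqr : o = p r) :
    CrossJunctionQ ends U h u p G o r :=
  ⟨hj.hne_hu, hj.hne_hp, hj.hne_up, hj.p_inj, hqr, hj.hext_o r hqr, hj.hhU, hj.huU, hj.hpU,
    hj.hloop_h, hj.hloop_u, hj.hnadj, hj.hnadj_p, hj.hup, hj.hcross, hj.hcross_adj,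
    hj.hcross_simple, hj.hu_adj_h, hj.hp_in, hj.hout⟩

/-- A `CrossJunction` is a cross junction with the mark anywhere. -/
theorem CrossJunction.toM (hj : CrossJunction ends U h u p G o) : CrossJunctionM ends U h u p G o :=
  ⟨hj.hne_hu, hj.hne_hp, hj.hne_up, hj.p_inj, hj.hhU, hj.huU, hj.hpU, hj.hloop_h, hj.hloop_u,
    hj.hnadj, hj.hnadj_p, hj.hup, hj.hcross, hj.hcross_adj, hj.hcross_simple, hj.hu_adj_h,
    hj.hp_in, hj.hout, fun i hi => absurd hi (hj.hop i)⟩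

/-- A `CrossJunctionU` is a cross junction with the mark anywhere (at the junction). -/
theorem CrossJunctionU.toM (hj : CrossJunctionU ends U h u p G) : CrossJunctionM ends U h u p G u :=
  ⟨hj.hne_hu, hj.hne_hp, hj.hne_up, hj.p_inj, hj.hhU, hj.huU, hj.hpU, hj.hloop_h, hj.hloop_u,
    hj.hnadj, hj.hnadj_p, hj.hup, hj.hcross, hj.hcross_adj, hj.hcross_simple, hj.hu_adj_h,
    hj.hp_in, fun x hx hxh _ hxu => hj.hout x hx hxh hxu, fun i hi => absurd hi (hj.hne_up i)⟩

/-- A `CrossJunctionQ` is a cross junction with the mark anywhere (at a dropped vertex). -/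
theorem CrossJunctionQ.toM {r : X} (hj : CrossJunctionQ ends U h u p G o r) :
    CrossJunctionM ends U h u p G o :=
  ⟨hj.hne_hu, hj.hne_hp, hj.hne_up, hj.p_inj, hj.hhU, hj.huU, hj.hpU, hj.hloop_h, hj.hloop_u,
    hj.hnadj, hj.hnadj_p, hj.hup, hj.hcross, hj.hcross_adj, hj.hcross_simple, hj.hu_adj_h,
    hj.hp_in, hj.hout, fun i hi => by
      have : i = r := hj.p_inj (hi.symm.trans hj.hqr)
      subst this
      exact hj.hext_r⟩

end Vocabulary

section Thm

variable [Fintype E] [DecidableEq E]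

open scoped Classical

variable {ends : E → Sym2 V} {X : Type u} [Fintype X] [DecidableEq X] [Nonempty X]
  {G : SimpleGraph X} [DecidableRel G.Adj] {U : Set V} {l h o u : V} {p : X → V}

/-- **Row 2′SW-ALL on every graph with a cross junction whose mark is any vertex other than
`h`** — by the position of the mark: at the junction (`swAll_of_crossJunctionU`), at a dropped
vertex (`swAll_of_crossJunctionQ_any`), elsewhere (`swAll_of_crossJunction_any`). -/
theorem swAll_of_crossJunctionM (hlh : l ≠ h) (hj : CrossJunctionM ends ({l}ᶜ) h u p G o) :
    SwAll ends l h o := by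
  by_cases hou : o = u
  · subst hou
    exact swAll_of_crossJunctionU hlh (hj.toU rfl)
  by_cases hop : ∃ r, o = p r
  · obtain ⟨r, hr⟩ := hop
    exact swAll_of_crossJunctionQ_any hlh (hj.toQ r hr)
  · exact swAll_of_crossJunction_any hlh (hj.toCrossJunction hou fun i hi => hop ⟨i, hi⟩)

/-- **Row (SW) on every graph with a cross junction whose mark is any vertex other than `h`** —
Theorem A_cross with the mark anywhere, at the class level (one junction, any simple cross graph,
no pieces). -/
theorem sw_of_crossJunctionM (hlh : l ≠ h) (hj : CrossJunctionM ends ({l}ᶜ) h u p G o) :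
    Sw ends l h o :=
  sw_of_swAll ends (swAll_of_crossJunctionM hlh hj)

end Thm

end CrossArm

end Summit.Ventures.PercRepro2
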